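import Summits.CriticalPhenomena.SAWScalingLimit.Theorems.SAWDefectDecoherenceMassRatioFlatRootDefs

/-!
# Glue of the line `flat-root-arc-swap` for the crux `SAWDefectDecoherence.MassRatio`
(stmt-CriticalPhenomena-8550; lead prover, crux protocol)

From the three registered stubs of the line — `RootSwapArc ε` for every `ε > 0` (root swap summed over
the swap arc), `ArcMassRatio c` for some `c < 3/4` (arc-rooted bulk mass against the far-arc arrival mass
from the tame root `b_δ` in the lattice half-disc `H_δ`), and `SwapArcPositive` (eventual positivity of
the arc mass) — as hypotheses in the predicate form of `…FlatRootDefs` (each registered stub delivers its predicate by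
definitional unfolding), the theorem `massRatio_of_flatRootStubs` concludes
`SAWDefectDecoherence.MassRatio` by name. The glue lemmas proved here: `Glue.rootSwapArc_of_rootSwap`
(pointwise ⇒ arc form), `Glue.arcMassRatio_of_split` (`HalfDiscArcArrival B → ArcRootedBulkMass A →
A + B ≤ c → ArcMassRatio c`, the typed two-certification form of the residual), `Glue.massRatioAt_of`
(First lemma / Transfer at every cut `c + ε`: multiply by the arc mass, swap the root, bound by
`ArcMassRatio`, `H_δ ⊆ Λ_δ` termwise, divide), `Glue.massRatio_of_massRatioAt` (`MassRatioAt (3/4)` is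
the crux). The registered sub-goal of the crux item proved here is `massRatio_of_flatRootStubs`. Sources: the
line card `Cruxes/MassRatio/Lines/flat-root-arc-swap.md`; skeleton `Cruxes/MassRatio/Lines/
flat_root_arc_swap.lean`; H. Duminil-Copin, S. Smirnov, Ann. of Math. 175 (2012) §3 for the observable.
Deliberately NOT here: any of the three stubs (they are open statements; `stub_swapArcPositive` lands
in its own file).
-/

noncomputable section


namespace Summit.CriticalPhenomena.SAWScalingLimit.Theorems.MassRatio.FlatRoot

open Literature.Probability.LatticeModels Literature.Probability.RandomPlanarGeometry
open Literature.Probability.RandomPlanarGeometry.SAW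
open Summit.CriticalPhenomena.SAWScalingLimit.Theses.SAWDefectDecoherence
open Summit.CriticalPhenomena.SAWScalingLimit.Theorems.MassRatio.Negative
open Summit.CriticalPhenomena.SAWScalingLimit.Theorems.MassRatio.Renewal (Z)
open scoped Classical

namespace Glue

/-! ## Glue (proved) -/

/-- `RootSwap ε → RootSwapArc ε` (sum the pointwise cross-ratio inequality over the finite arc). -/
theorem rootSwapArc_of_rootSwap {ε : ℝ} (h : RootSwap ε) : RootSwapArc ε := by
  intro D ρ Λ m a b hF K hK hKD
  obtain ⟨C, hC⟩ := h D ρ Λ m a b hF K hK hKD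
  refine ⟨C, hC.mono fun δ hδ => ?_⟩
  have hfin := swapArc_finite D ρ Λ δ
  rw [finsum_mem_eq_finite_toFinset_sum _ hfin, finsum_mem_eq_finite_toFinset_sum _ hfin,
    Finset.mul_sum, Finset.mul_sum]
  exact Finset.sum_le_sum fun a' ha' => hδ a' (hfin.mem_toFinset.1 ha')

/-- **The absolute split** of the residual: a far-arc arrival lower bound at exponent `B` and an
arc-rooted bulk upper bound at exponent `A` with `A + B ≤ c` give `ArcMassRatio c` (the two sharp
certifications of the necessity ledger `Cruxes/MassRatio/Ideator6Necessity.md`, typed). -/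
theorem arcMassRatio_of_split {A B c : ℝ} (hABc : A + B ≤ c) (hArr : HalfDiscArcArrival B)
    (hBulk : ArcRootedBulkMass A) : ArcMassRatio c := by
  intro D ρ Λ m a b hF K hK hKD
  obtain ⟨c₀, hc₀, h₁⟩ := hArr D ρ Λ m a b hF
  obtain ⟨C, h₂⟩ := hBulk D ρ Λ m a b hF K hK hKD
  have h₀ : ∀ᶠ δ : ℝ in nhdsWithin 0 (Set.Ioi 0), 0 < δ := eventually_mem_nhdsWithin
  have h₀' : ∀ᶠ δ : ℝ in nhdsWithin 0 (Set.Ioi 0), δ < 1 :=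
    (eventually_lt_nhds zero_lt_one).filter_mono nhdsWithin_le_nhds
  refine ⟨max C 0 / c₀, ?_⟩
  filter_upwards [h₀, h₀', h₁, h₂] with δ hδ hδ1 hδ₁ hδ₂
  set SH := ∑ᶠ a' ∈ swapArc D ρ Λ δ, Z (halfDisc D ρ Λ δ) (b δ) a' with hSH_def
  set M := ∑ᶠ a' ∈ swapArc D ρ Λ δ, massK (Λ δ) a' δ K with hM_def
  have hA0 : 0 ≤ δ ^ (-A) := Real.rpow_nonneg hδ.le _
  have hB0 : 0 < δ ^ B := Real.rpow_pos_of_pos hδ _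
  have step1 : M ≤ max C 0 * δ ^ (-A) :=
    hδ₂.trans (mul_le_mul_of_nonneg_right (le_max_left _ _) hA0)
  have hexp : δ ^ (-A) = δ ^ (-(A + B)) * δ ^ B := by
    rw [← Real.rpow_add hδ]; congr 1; ring
  have hmono : δ ^ (-(A + B)) ≤ δ ^ (-c) :=
    Real.rpow_le_rpow_of_exponent_ge hδ hδ1.le (by linarith)
  have step2 : δ ^ (-A) ≤ δ ^ (-c) * (SH / c₀) := by
    rw [hexp]
    have h3 : δ ^ B ≤ SH / c₀ := by
      rw [le_div_iff₀ hc₀]; linarith [hδ₁]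
    exact mul_le_mul hmono h3 hB0.le (Real.rpow_nonneg hδ.le _)
  calc M ≤ max C 0 * δ ^ (-A) := step1
    _ ≤ max C 0 * (δ ^ (-c) * (SH / c₀)) := mul_le_mul_of_nonneg_left step2 (le_max_right _ _)
    _ = max C 0 / c₀ * δ ^ (-c) * SH := by
        field_simp

/-- **First lemma / Transfer at a general cut.** `RootSwapArc ε`, `ArcMassRatio c` and positivity of
the arc mass give `MassRatioAt (c + ε)`: multiply the crux's left side by the arc mass
`S_Λ = Z_{Λ_δ}(b_δ → S_δ) > 0`, apply the root swap, bound the arc-rooted bulk mass by `ArcMassRatio`,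
push `Z_{H_δ} ≤ Z_{Λ_δ}` termwise (`arcSum_halfDisc_le`), multiply the exponents, divide by `S_Λ`. -/
theorem massRatioAt_of {ε c : ℝ} (hR : RootSwapArc ε) (hA : ArcMassRatio c)
    (hP : ∀ (D : DobrushinDomain) (ρ : ℝ) (Λ : ℝ → Finset HexVertex) (m : ℝ → ℤ)
      (a b : ℝ → Sym2 HexVertex), SwapArcPositive D ρ Λ m a b) : MassRatioAt (c + ε) := by
  intro D ρ Λ m a b hF K hK hKD
  obtain ⟨C₁, h₁⟩ := hA D ρ Λ m a b hF K hK hKD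
  obtain ⟨C₂, h₂⟩ := hR D ρ Λ m a b hF K hK hKD
  have h₃ := hP D ρ Λ m a b hF
  have h₀ : ∀ᶠ δ : ℝ in nhdsWithin 0 (Set.Ioi 0), 0 < δ := eventually_mem_nhdsWithin
  refine ⟨max C₂ 0 * max C₁ 0, ?_⟩
  filter_upwards [h₀, h₁, h₂, h₃] with δ hδ hδ₁ hδ₂ hδ₃
  have hfin : (swapArc D ρ Λ δ).Finite := swapArc_finite D ρ Λ δ
  set SΛ := ∑ᶠ a' ∈ swapArc D ρ Λ δ, Z (Λ δ) (b δ) a' with hSΛ_def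
  set SH := ∑ᶠ a' ∈ swapArc D ρ Λ δ, Z (halfDisc D ρ Λ δ) (b δ) a' with hSH_def
  set M := ∑ᶠ a' ∈ swapArc D ρ Λ δ, massK (Λ δ) a' δ K with hM_def
  have hM0 : 0 ≤ M := finsum_mem_nonneg_of_finite hfin fun a' _ => massK_nonneg _ _ _ _
  have hSH0 : 0 ≤ SH := finsum_mem_nonneg_of_finite hfin fun a' _ => norm_nonneg _
  have hSH : SH ≤ SΛ := arcSum_halfDisc_le D ρ Λ δ (b δ)
  have hZ0 : 0 ≤ Z (Λ δ) (a δ) (b δ) := norm_nonneg _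
  have hε0 : 0 ≤ δ ^ (-ε) := Real.rpow_nonneg hδ.le _
  have hc0 : 0 ≤ δ ^ (-c) := Real.rpow_nonneg hδ.le _
  -- step 1: root swap, with a nonnegative constant
  have step1 : massK (Λ δ) (a δ) δ K * SΛ ≤ max C₂ 0 * δ ^ (-ε) * Z (Λ δ) (a δ) (b δ) * M := by
    refine hδ₂.trans ?_
    have hx : 0 ≤ δ ^ (-ε) * Z (Λ δ) (a δ) (b δ) * M := mul_nonneg (mul_nonneg hε0 hZ0) hM0
    calc C₂ * δ ^ (-ε) * Z (Λ δ) (a δ) (b δ) * M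
        = C₂ * (δ ^ (-ε) * Z (Λ δ) (a δ) (b δ) * M) := by ring
      _ ≤ max C₂ 0 * (δ ^ (-ε) * Z (Λ δ) (a δ) (b δ) * M) :=
          mul_le_mul_of_nonneg_right (le_max_left _ _) hx
      _ = max C₂ 0 * δ ^ (-ε) * Z (Λ δ) (a δ) (b δ) * M := by ring
  -- step 2: arc mass ratio, then `H_δ ⊆ Λ_δ`
  have step2 : M ≤ max C₁ 0 * δ ^ (-c) * SΛ := by
    refine hδ₁.trans ?_
    have hx : 0 ≤ δ ^ (-c) * SH := mul_nonneg hc0 hSH0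
    calc C₁ * δ ^ (-c) * SH = C₁ * (δ ^ (-c) * SH) := by ring
      _ ≤ max C₁ 0 * (δ ^ (-c) * SH) := mul_le_mul_of_nonneg_right (le_max_left _ _) hx
      _ = max C₁ 0 * δ ^ (-c) * SH := by ring
      _ ≤ max C₁ 0 * δ ^ (-c) * SΛ :=
          mul_le_mul_of_nonneg_left hSH (mul_nonneg (le_max_right _ _) hc0)
  -- exponents add
  have hexp : δ ^ (-ε) * δ ^ (-c) = δ ^ (-(c + ε)) := by
    rw [← Real.rpow_add hδ]; congr 1; ring
  have step3 : massK (Λ δ) (a δ) δ K * SΛ ≤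
      (max C₂ 0 * max C₁ 0 * δ ^ (-(c + ε)) * Z (Λ δ) (a δ) (b δ)) * SΛ := by
    calc massK (Λ δ) (a δ) δ K * SΛ
        ≤ max C₂ 0 * δ ^ (-ε) * Z (Λ δ) (a δ) (b δ) * M := step1
      _ ≤ max C₂ 0 * δ ^ (-ε) * Z (Λ δ) (a δ) (b δ) * (max C₁ 0 * δ ^ (-c) * SΛ) :=
          mul_le_mul_of_nonneg_left step2 (mul_nonneg (mul_nonneg (le_max_right _ _) hε0) hZ0)
      _ = (max C₂ 0 * max C₁ 0 * (δ ^ (-ε) * δ ^ (-c)) * Z (Λ δ) (a δ) (b δ)) * SΛ := by ring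
      _ = (max C₂ 0 * max C₁ 0 * δ ^ (-(c + ε)) * Z (Λ δ) (a δ) (b δ)) * SΛ := by rw [hexp]
  exact le_of_mul_le_mul_right step3 hδ₃

/-- The same with the POINTWISE root swap. -/
theorem massRatioAt_of_rootSwap {ε c : ℝ} (hR : RootSwap ε) (hA : ArcMassRatio c)
    (hP : ∀ (D : DobrushinDomain) (ρ : ℝ) (Λ : ℝ → Finset HexVertex) (m : ℝ → ℤ)
      (a b : ℝ → Sym2 HexVertex), SwapArcPositive D ρ Λ m a b) : MassRatioAt (c + ε) :=
  massRatioAt_of (rootSwapArc_of_rootSwap hR) hA hP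

/-- `MassRatioAt (3/4)` is the crux (definitional unfolding; the crux writes `-(3:ℝ)/4`). -/
theorem massRatio_of_massRatioAt (h : MassRatioAt (3 / 4)) : MassRatio := by
  intro D ρ Λ m a b Zc hρ hflat hadm hexh ha hb K hK hKD
  obtain ⟨C, hC⟩ := h D ρ Λ m a b ⟨hρ, hflat, hadm, hexh, ha, hb⟩ K hK hKD
  refine ⟨C, hC.mono fun δ hδ => ?_⟩
  rw [neg_div]
  exact hδ

end Glue

open Glue

/-! ## Composition: the line concludes the crux from its three registered stubs -/

/-- **The line `flat-root-arc-swap` concludes the crux from its three open statements** — the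
registered stubs of the crux item in predicate form (`stub_rootSwapArc` is `∀ ε > 0, RootSwapArc ε`,
`stub_arcMassRatio` is `∃ c < 3/4, ArcMassRatio c`, `stub_swapArcPositive` is `SwapArcPositive` at
every datum, each by definitional unfolding): some `c < 3/4` with `ArcMassRatio c` (stub 2), the root
swap at `ε := 3/4 − c > 0` (stub 1), positivity of the swap arc (stub 3), through `massRatioAt_of` at
the cut `c + ε = 3/4`. This is the registered sub-goal `massRatio_of_flatRootStubs` of the crux item. -/
theorem massRatio_of_flatRootStubs : (∀ ε : ℝ, 0 < ε → RootSwapArc ε) → (∃ c : ℝ, c < 3 / 4 ∧ ArcMassRatio c) → (∀ (D : DobrushinDomain) (ρ : ℝ) (Λ : ℝ → Finset HexVertex) (m : ℝ → ℤ) (a b : ℝ → Sym2 HexVertex), SwapArcPositive D ρ Λ m a b) → MassRatio := by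
  intro hRS hAMR hP
  obtain ⟨c, hc, hA⟩ := hAMR
  have hR : RootSwapArc (3 / 4 - c) := hRS (3 / 4 - c) (by linarith)
  have h : MassRatioAt (3 / 4) := by
    have h' := massRatioAt_of hR hA hP
    have e : c + (3 / 4 - c) = 3 / 4 := by ring
    rw [e] at h'
    exact h'
  exact massRatio_of_massRatioAt h

end Summit.CriticalPhenomena.SAWScalingLimit.Theorems.MassRatio.FlatRoot
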